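import Mathlib
import Summits.Ventures.PercRepro2.KPrimeVYEdge

/-!
# The algebra of the `v`–`b` edge step of the `v`-exploration of `(K′)`
(blind cell PercRepro2, mine-c g35; `conjectures/MINE-C.md` §44.1)

`vb_form_nonneg` is the purely algebraic core of `kprimeHolds_of_update_zero_vb`
(`KPrimeVBEdge.lean`): once the world-`1` masses of the cleared `(K′)` form at an edge
`e = {x, b}` from the root of `v` are written through the dictionary
(`S¹ = Sm − Ysb`, `H¹ = H − Db + Ob`, `YS¹ = Ys − Yb2`, `D₀¹ = d0 − n0`, `A¹ = H¹`, `C¹ = D¹`,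
`N₀¹ = 0`, `(0,1)ᵉ¹ = (0,1)¹`), the parent's form satisfies the EXACT identity

  `Sm·S¹·form = (1 − t)·Sm(p)·S¹·G⁰ + t·(D₀ − N₀)·Sm(p)·Sm·Q¹ + t(1 − t)·PA·(G⁰_b + D₀·Sm·B̂)`

with `G⁰`, `G⁰_b` the world-`0` forms (marks `y` / `b`) at the parent's threshold (`≥ 0` by the
threshold lemma `thr_nonneg`), `Q¹` the world-`1` `E`-slope, `PA = Sm·Yb2 − Ysb·Ys`,
`B̂ = H − Db − A`, and every factor `≥ 0`; the degenerate cases `Sm = 0` and `S¹ = 0` are handled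
separately (the form is then `0`, resp. `(1 − t)²·G⁰`).
-/

namespace Summit.Ventures.PercRepro2

namespace KPrime

variable {R : Type*} [Field R] [LinearOrder R] [IsStrictOrderedRing R]

/-- The algebra of the `v`–`b` step (`MINE-C.md` §44.1).  World `1` (`b ∈ V′`): `A¹ = H¹`,
`C¹ = D¹`, `N₀¹ = 0`, `(0,1)ᵉ¹ = (0,1)¹`; dictionary `S¹ = Sm − Ysb`, `H¹ = H − Db + Ob`,
`YS¹ = Ys − Yb2`, `D₀¹ = d0 − n0`.  With `S¹ = Sm − Ysb` the parent's form satisfies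
`Sm · S¹ · form = (1 − t)·Sm(p)·S¹·G⁰ + t·(D₀ − N₀)·Sm(p)·Sm·Q¹ + t(1 − t)·PA·(G⁰_b + D₀·Sm·B̂)`
with `G⁰`, `G⁰_b` the world-`0` forms (marks `y` / `b`) at the parent's threshold, `Q¹` the
world-`1` slope, `PA = Sm·Yb2 − Ysb·Ys`, `B̂ = H − Db − A` — every factor `≥ 0`. -/
lemma vb_form_nonneg {t A H Ys Sm Oe O C D n0 d0 Ysb Ob Db Yb2 D1 O11 : R}
    (ht0 : 0 ≤ t) (ht1 : t ≤ 1) (hSm : 0 ≤ Sm) (hYs : 0 ≤ Ys) (hYsb : 0 ≤ Ysb) (hO : 0 ≤ O)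
    (hOb : 0 ≤ Ob) (hO11 : 0 ≤ O11) (hYb2 : 0 ≤ Yb2) (hD1 : 0 ≤ D1) (hd0 : 0 ≤ d0)
    (hn0 : 0 ≤ n0) (hn0d0 : n0 ≤ d0)
    (hS1 : 0 ≤ Sm - Ysb) (hYs_le : Ys ≤ Sm) (hYS1 : 0 ≤ Ys - Yb2)
    (hYS1_le : Ys - Yb2 ≤ Sm - Ysb) (hH1 : 0 ≤ H - Db + Ob) (hH1_le : H - Db + Ob ≤ Sm - Ysb)
    (hD1_le : D1 ≤ Ys - Yb2) (hO11_le : O11 ≤ Sm - Ysb) (hBh : A + Db ≤ H)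
    (hβ : D * Sm ≤ H * Ys) (hβb : Db * Sm ≤ H * Ysb)
    (hQ1 : D1 * (Sm - Ysb) ≤ (H - Db + Ob) * (Ys - Yb2)) (hPA : Ysb * Ys ≤ Sm * Yb2)
    (h0 : 0 ≤ (A * d0 - n0 * H) * Ys + Sm * ((Oe * d0 - n0 * O) - (C * d0 - n0 * D)))
    (h0b : 0 ≤ (A * d0 - n0 * H) * Ysb + Sm * ((Ob * d0 - n0 * Ob) - (0 * d0 - n0 * Db))) :
    0 ≤ ((t * (H - Db + Ob) + (1 - t) * A) * (t * (d0 - n0) + (1 - t) * d0) -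
          (t * 0 + (1 - t) * n0) * (t * (H - Db + Ob) + (1 - t) * H)) *
          (t * (Ys - Yb2) + (1 - t) * Ys) +
        (t * (Sm - Ysb) + (1 - t) * Sm) *
          (((t * O11 + (1 - t) * Oe) * (t * (d0 - n0) + (1 - t) * d0) -
              (t * 0 + (1 - t) * n0) * (t * O11 + (1 - t) * O)) -
            ((t * D1 + (1 - t) * C) * (t * (d0 - n0) + (1 - t) * d0) -
              (t * 0 + (1 - t) * n0) * (t * D1 + (1 - t) * D))) := by
  have h1t : 0 ≤ 1 - t := sub_nonneg.2 ht1
  -- the slopes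
  have hβ' : 0 ≤ H * Ys + Sm * (O - D) := by linarith [mul_nonneg hSm hO]
  have hβb' : 0 ≤ H * Ysb + Sm * (Ob - Db) := by linarith [mul_nonneg hSm hOb]
  -- the two world-`0` forms at the parent's threshold `(N₀, D₀) = ((1 − t) n0, d0 − t n0)`
  have hND : (1 - t) * n0 * d0 ≤ n0 * (t * (d0 - n0) + (1 - t) * d0) := by
    linarith [mul_nonneg (mul_nonneg ht0 hn0) (sub_nonneg.2 hn0d0)]
  have hDle : t * (d0 - n0) + (1 - t) * d0 ≤ d0 := by linarith [mul_nonneg ht0 hn0]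
  have hNle : (1 - t) * n0 ≤ t * (d0 - n0) + (1 - t) * d0 := by linarith
  have hG0 : 0 ≤ (t * (d0 - n0) + (1 - t) * d0) * (A * Ys + Sm * (Oe - C)) -
      (1 - t) * n0 * (H * Ys + Sm * (O - D)) :=
    thr_nonneg hβ' hd0 (mul_nonneg h1t hn0) hDle hNle hND (by linarith [h0])
  have hGb0 : 0 ≤ (t * (d0 - n0) + (1 - t) * d0) * (A * Ysb + Sm * Ob) -
      (1 - t) * n0 * (H * Ysb + Sm * (Ob - Db)) :=
    thr_nonneg hβb' hd0 (mul_nonneg h1t hn0) hDle hNle hND (by linarith [h0b])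
  -- the world-`1` slope and the PA term
  have hQ1' : 0 ≤ (H - Db + Ob) * (Ys - Yb2) + (Sm - Ysb) * (O11 - D1) := by
    linarith [mul_nonneg hS1 hO11]
  have hPA' : 0 ≤ (Sm - Ysb) * Ys - Sm * (Ys - Yb2) := by linarith
  have hD₀N₀ : 0 ≤ t * (d0 - n0) + (1 - t) * d0 - (t * 0 + (1 - t) * n0) := by linarith
  have hD₀ : 0 ≤ t * (d0 - n0) + (1 - t) * d0 := by linarith [mul_nonneg h1t hn0]
  have hSmp : 0 ≤ t * (Sm - Ysb) + (1 - t) * Sm :=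
    add_nonneg (mul_nonneg ht0 hS1) (mul_nonneg h1t hSm)
  have hBh' : 0 ≤ H - Db - A := by linarith
  rcases hSm.eq_or_lt with hSm0 | hSmpos
  · -- `Sm = 0`: every `S`-mass is `0`
    have e1 : Ysb = 0 := by linarith
    have e2 : Ys = 0 := by linarith
    have e3 : Yb2 = 0 := by linarith
    rw [← hSm0, e1, e2, e3]; linarith
  rcases hS1.eq_or_lt with hS10 | hS1pos
  · -- `S¹ = 0`: the world-`1` `S`-masses vanish and the form is `(1 − t)² · G⁰`
    have e1 : Ysb = Sm := by linarith
    have e2 : Yb2 = Ys := by linarith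
    have e3 : Ob = Db - H := by linarith
    have e4 : O11 = 0 := by linarith
    have e5 : D1 = 0 := by linarith
    rw [e1, e2, e3, e4, e5]
    linarith [mul_nonneg (mul_nonneg h1t h1t) hG0]
  · have key : Sm * (Sm - Ysb) *
        (((t * (H - Db + Ob) + (1 - t) * A) * (t * (d0 - n0) + (1 - t) * d0) -
          (t * 0 + (1 - t) * n0) * (t * (H - Db + Ob) + (1 - t) * H)) *
          (t * (Ys - Yb2) + (1 - t) * Ys) +
        (t * (Sm - Ysb) + (1 - t) * Sm) *
          (((t * O11 + (1 - t) * Oe) * (t * (d0 - n0) + (1 - t) * d0) -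
              (t * 0 + (1 - t) * n0) * (t * O11 + (1 - t) * O)) -
            ((t * D1 + (1 - t) * C) * (t * (d0 - n0) + (1 - t) * d0) -
              (t * 0 + (1 - t) * n0) * (t * D1 + (1 - t) * D)))) =
        (1 - t) * (t * (Sm - Ysb) + (1 - t) * Sm) * (Sm - Ysb) *
            ((t * (d0 - n0) + (1 - t) * d0) * (A * Ys + Sm * (Oe - C)) -
              (1 - t) * n0 * (H * Ys + Sm * (O - D))) +
          t * (t * (d0 - n0) + (1 - t) * d0 - (t * 0 + (1 - t) * n0)) *
            (t * (Sm - Ysb) + (1 - t) * Sm) * Sm *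
            ((H - Db + Ob) * (Ys - Yb2) + (Sm - Ysb) * (O11 - D1)) +
          t * (1 - t) * ((Sm - Ysb) * Ys - Sm * (Ys - Yb2)) *
            (((t * (d0 - n0) + (1 - t) * d0) * (A * Ysb + Sm * Ob) -
                (1 - t) * n0 * (H * Ysb + Sm * (Ob - Db))) +
              (t * (d0 - n0) + (1 - t) * d0) * Sm * (H - Db - A)) := by ring
    have hR : 0 ≤ (1 - t) * (t * (Sm - Ysb) + (1 - t) * Sm) * (Sm - Ysb) *
            ((t * (d0 - n0) + (1 - t) * d0) * (A * Ys + Sm * (Oe - C)) -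
              (1 - t) * n0 * (H * Ys + Sm * (O - D))) +
          t * (t * (d0 - n0) + (1 - t) * d0 - (t * 0 + (1 - t) * n0)) *
            (t * (Sm - Ysb) + (1 - t) * Sm) * Sm *
            ((H - Db + Ob) * (Ys - Yb2) + (Sm - Ysb) * (O11 - D1)) +
          t * (1 - t) * ((Sm - Ysb) * Ys - Sm * (Ys - Yb2)) *
            (((t * (d0 - n0) + (1 - t) * d0) * (A * Ysb + Sm * Ob) -
                (1 - t) * n0 * (H * Ysb + Sm * (Ob - Db))) +
              (t * (d0 - n0) + (1 - t) * d0) * Sm * (H - Db - A)) := by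
      refine add_nonneg (add_nonneg ?_ ?_) ?_
      · exact mul_nonneg (mul_nonneg (mul_nonneg h1t hSmp) hS1) hG0
      · exact mul_nonneg (mul_nonneg (mul_nonneg (mul_nonneg ht0 hD₀N₀) hSmp) hSm) hQ1'
      · exact mul_nonneg (mul_nonneg (mul_nonneg ht0 h1t) hPA')
          (add_nonneg hGb0 (mul_nonneg (mul_nonneg hD₀ hSm) hBh'))
    rw [← key] at hR
    have h1 := (mul_nonneg_iff_of_pos_left hSmpos).1
      ((mul_assoc Sm (Sm - Ysb) _).symm ▸ hR)
    exact (mul_nonneg_iff_of_pos_left hS1pos).1 h1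

end KPrime

end Summit.Ventures.PercRepro2
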